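import Mathlib
import Summits.NavierStokesRegularity.NavierStokesRegularity.Theses.TypeIQuarterGate
import Summits.NavierStokesRegularity.NavierStokesRegularity.Theses.ExtremalTypeIConstant
import Summits.NavierStokesRegularity.NavierStokesRegularity.Theorems.ExtremalTypeIConstantSelfSimilarExcluded
import Summits.NavierStokesRegularity.NavierStokesRegularity.Theorems.SqueezeCycleExtremalElementExistsExtraction
import Summits.NavierStokesRegularity.NavierStokesRegularity.Theorems.SymmetryModuliCountLinearLiouvilleSevenFiniteEnergy
import Summits.NavierStokesRegularity.NavierStokesRegularity.Theorems.LerayQuarterDissipationFiniteDissipationLiouvilleDssCorners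
import Summits.NavierStokesRegularity.NavierStokesRegularity.Theorems.TypeIQuarterGateScarZoomDefs
import Summits.NavierStokesRegularity.NavierStokesRegularity.Theorems.QuarterLogPincerThinCascadeDefs
import Literature.Analysis.FluidPDE.TypeIAncientMild
import Literature.Analysis.FluidPDE.TypeIAncientMildRescale
import Literature.Analysis.FluidPDE.SelfSimilar
import Literature.Analysis.FluidPDE.ChaeWolfRemovingDSS
import Summits.NavierStokesRegularity.NavierStokesRegularity.Theorems.QuantisedSymmetryPolyhedralDssProfileExistsStubAncientMildOfClassicalTypeI
import Literature.Barriers.NavierStokesRegularity.NearOneDssTypeIExclusion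

/-!
# Line `axis-activity` — DSS-wall rung line filed under crux `TypeIQuarterGate.ScarEnvelopeTypeI`
(stmt-NavierStokesRegularity-23843). Seat ns-idea-7 g3, lens «nearmiss», target «DSS wall».

**No summit is proved by this line, and it does NOT conclude the crux `ScarEnvelopeTypeI`.**
It is a rung line on the crux's wall: the crux's conclusion — the SPACE–TIME ENVELOPE
`‖u(t,x)‖ ≤ C' + Σ C'/(‖x − a‖ + √(T − t))` of a Type-I blow-up — is exactly what feeds blow-up zooms
into the envelope class `HasTypeIDecay C₀` in which the DSS wall (`TypeIDSSLiouville`) and its one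
theorem, the near-one exclusion of Chae–Wolf 2017 (Thm 1.3 = tree `chaeWolf2017_removing_dss_holds`,
barrier `NearOneDssTypeIExclusion`, scope caveat (a): the Type-I ENVELOPE on all of `ℝ³ × (−∞,0)`;
caveat (d): the envelope is derived only from `C((−∞,0);Lᵖ)`, Thm 1.1), are stated.  This line shows
that ON THE NEAR-ONE LANE THE ENVELOPE IS NOT NEEDED: the measured deficit "envelope hypothesis" of
the near-one theorem is removed, in the time-rate class `IsTypeIAncientMild M` (KNSS Oseen gauge,
`‖u(t,x)‖ ≤ M/√(−t)`, NO spatial decay) that Type-I blow-up zooms actually deliver.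

## Mechanism (the lever: AXIS ACTIVITY)

In Chae–Wolf's indirect argument (nontrivial `λₙ`-DSS solutions, `λₙ → 1`, converge to a nontrivial
SELF-SIMILAR solution, killed by Tsai) the envelope is used exactly once: to keep the point of
nontriviality at BOUNDED similarity ratio `‖x‖/√(−t)` (the envelope `C₀/(‖x‖+√(−t))` forces every
point with `√(−t)‖u‖ ≥ ε` to have ratio `≤ C₀/ε`), so that the symmetry centre does not escape to
infinity in the limit.  The lever replacing it is a structural fact about the time-rate class:

* `AxisActivity` (S_A, NEW — PROVED in this file as `axisActivity_proof`, v4): there are `ε > 0` (absolute) and `R₀ = R₀(M)` such that every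
  NONTRIVIAL `u ∈ A_M = IsTypeIAncientMild M` has a point with `‖x‖ < R₀ √(−t)` and
  `√(−t)‖u(t,x)‖ ≥ ε` — activity inside the parabola around the time axis (hence, by translation
  invariance of the class, around EVERY vertical axis).  Proof sketch (provable now from tree
  theorems): if `u` is `ε`-quiet in the parabola `{‖x‖ < R√(−t)}` with `R` huge, recentre at an active
  point of nearly minimal ratio `ρ ≥ R` and rescale it to time `−1`; in the new frame `u` is
  `ε`-quiet on `{t < −1, ‖z‖ < ρ(√(−t) − 1) − 1}`, which exhausts the past `t < −1` as `R → ∞`; the class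
  compactness `exists_tendsto_of_isTypeIAncientMild_seq` (KNSS Lemma 6.1 + Prop 4.1, tree theorem)
  gives a limit in `A_M`, `ε`-quiet on the whole end `t ≤ −2`, hence ZERO by the small-constant
  Liouville on an end `exists_typeIAncientMild_eq_zero_of_small_on_end` (tree theorem), yet of size
  `≥ ε` at `(−1, 0)` — contradiction (continuity on the open slab).  The same end-Liouville shows the
  active set of a nontrivial element is nonempty.
* `ScaleDensification` (S_D — PROVED in this file as `scaleDensification_proof`, v3; was a stub in v1/v2): a pointwise limit `W ∈ A_M` of `cₙ`-DSS fields `vₙ ∈ A_M` with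
  `cₙ → 1` is scale invariant on `t < 0` (`cₙ^{kₙ} → μ` for every `μ > 0`; the class-uniform KNSS
  Prop 4.1 bounds IN THE TREE — `Theorems.exists_norm_iteratedFDeriv_le_of_typeI` (spatial gradient) and
  `Theorems.exists_lipschitz_time_of_typeI` (time-Lipschitz) — pass the pointwise convergence through the
  moving arguments `(cₙ^{2kₙ}t, cₙ^{kₙ}x)`).
* `SelfSimilarGenerator` (S_G — PROVED in this file as `selfSimilarGenerator_proof`, v2): scale invariance of a smooth field on `t < 0` gives the
  infinitesimal generator identity `∇W·x + W + 2t ∂ₜW = 0` (differentiate `μ ↦ μW(μ²t, μx)` at `μ = 1`),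
  the hypothesis form of the CLOSED item `ExtremalTypeIConstant.SelfSimilarExcluded`
  (stmt-NavierStokesRegularity-8219, proved: Tsai 1998 Thm 1 at `q = ∞` via `BoundedProfileConstant`
  stmt-8220 + the Oseen identity).

v7 (2026-08-28T10:40Z): + `thinObject_not_nearOneDss` — the same constraint on the residual THIN OBJECT of 24077's
registered line `thin_cascade` (S3's object class).

v6 (2026-08-28T10:30Z): + `chaeWolf_of_nearOneRateDss : NearOneRateDss → chaeWolf2017_removing_dss` (kernel, via the
tree's `isTypeIAncientMild_of_classical_typeI`): the rung DOMINATES Chae–Wolf 2017 Thm 1.3 — it is that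
theorem with the envelope hypothesis dropped (the tree already proves CW 1.3 itself,
`chaeWolf2017_removing_dss_holds`; this only certifies the comparison).

v5 (2026-08-28T10:10Z): + the CONSUMER COROLLARY `twinScarObject_not_nearOneDss` (end of file): the residual
object of both registered 23843 lines — an A–B-class twin-scar Type-I ancient mild solution
`ScarZoom.TwinScarObject M v` — is not `c`-DSS about any centre for `1 < c < c₁(M)` (kernel; a proved
CONSTRAINT on the residual enemy, like SF; not a kill).

KERNEL-CHECKED HERE (v4: the file has NO `sorry` — S_A `axisActivity_proof`, S_D `scaleDensification_proof`,
S_G `selfSimilarGenerator_proof` are proved below, and `nearOneRateDss_proof : NearOneRateDss` is a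
sorry-free theorem of this workfile; landing it under `Theorems/` is the LEAD's / a prover's proposal,
this seat is files-only):
`nearOneRateDss_of : AxisActivity → ScaleDensification → SelfSimilarGenerator →
NearOneRateDss`, the indirect argument itself — choice of a violating sequence `cₙ ↓ 1`, active points
by S_A, parabolic rescaling to time `−1` (`IsTypeIAncientMild.nsRescale`, commuting scalings keep the
DSS about the origin), Bolzano–Weierstrass for the marked points, the class compactness theorem BY
NAME, nontriviality of the limit at `(−1, y_inf)` through locally uniform slice convergence, S_D, S_G,
and `extremalTypeIConstant_selfSimilarExcluded_proof` BY NAME.  The printed ENVELOPE form inside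
the gauge class is already a tree theorem (`nearOneEnvelope_inTree` =
`FiniteDissipationLiouville.Birth.exists_dss_threshold_of_envelope`, threshold `c₁(C₀)`); the rung
deletes its envelope hypothesis and makes the threshold depend on the rate constant `M`
(`nearOneEnvelope_of_nearOneRate`).

`NearOneRateDss` is STRICTLY STRONGER than the near-one theorem in print (same conclusion, weaker
hypothesis: rate instead of envelope; the gauge class is the tree's zoom-limit class) and strictly
weaker than `NoTypeI` / the crux.  It is not the DSS wall (coarse ratios untouched) and says so.
-/

noncomputable section

namespace Summit.NavierStokesRegularity.NavierStokesRegularity.Cruxes.ScarEnvelopeTypeI.AxisActivity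

open MeasureTheory Set Function Filter Topology Bornology
open Literature.Analysis Literature.Analysis.FluidPDE
open Summit.NavierStokesRegularity.NavierStokesRegularity.Theorems
open Summit.NavierStokesRegularity.NavierStokesRegularity.Theses.ExtremalTypeIConstant

/-- Local notation for physical space `ℝ³`. -/
local notation "E3" => EuclideanSpace ℝ (Fin 3)

/-! ## The statements -/

/-- **S_A — AXIS ACTIVITY (the lever; PROVED below, `axisActivity_proof`, v4; was the stub `stub_axisActivity` in v1–v3).**  There is an absolute
`ε > 0` and, for every rate constant `M`, a ratio `R₀ = R₀(M)` such that every nontrivial Type-I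
ancient mild field `u ∈ A_M` (KNSS Oseen gauge, `‖u(t,x)‖ ≤ M/√(−t)`, no spatial decay assumed) is
ACTIVE INSIDE THE PARABOLA OF APERTURE `R₀` AROUND THE TIME AXIS: some `(x,t)`, `t < 0`,
`‖x‖ < R₀√(−t)`, carries `√(−t)‖u(t,x)‖ ≥ ε`.  (By translation invariance of the class the same holds
around every vertical axis.)  This is the substitute for the Type-I ENVELOPE in every
symmetry-densification argument on the DSS wall.  Why it might fail: it does not, if the sketch in
the module docstring is right — the risk is the bookkeeping of the quiet region under recentring
(the region `{t<−1, ‖z‖ < ρ(√(−t)−1)−1}` must exhaust the past as `ρ → ∞`; it does).  Sources: KNSS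
2009 Lemma 6.1 / Prop 4.1 (arXiv:0709.3599) = tree `exists_tendsto_of_isTypeIAncientMild_seq`;
Leray 1934 (3.9) = tree `exists_typeIAncientMild_eq_zero_of_small_on_end`. -/
def AxisActivity : Prop :=
  ∃ ε : ℝ, 0 < ε ∧ ∀ M : ℝ, ∃ R₀ : ℝ, ∀ u : ℝ → E3 → E3, IsTypeIAncientMild M u →
    (∃ t < 0, ∃ x, u t x ≠ 0) →
      ∃ t < 0, ∃ x : E3, ‖x‖ < R₀ * Real.sqrt (-t) ∧ ε ≤ Real.sqrt (-t) * ‖u t x‖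

/-- **S_D — SCALE DENSIFICATION (PROVED below, `scaleDensification_proof`, v3; was a stub in v1/v2).**  If `vₙ ∈ A_M` are `cₙ`-discretely
self-similar with `cₙ > 1`, `cₙ → 1`, and converge pointwise on the open slab to `W ∈ A_M`, then `W`
is invariant under EVERY parabolic scaling on `t < 0`: `μ W(μ²t, μx) = W(t,x)` for all `μ > 0`.
(For `μ > 0` pick `kₙ ∈ ℤ` with `cₙ^{kₙ} → μ`; `vₙ = (vₙ)_{cₙ^{kₙ}}`; the uniform KNSS Prop 4.1
bounds of the class make the family equicontinuous on compact subsets of the open slab, so pointwise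
convergence is locally uniform in space–time and passes through the moving arguments
`(cₙ^{2kₙ}t, cₙ^{kₙ}x)`.)  Why it might fail: only through a slip in the equicontinuity-in-time step
(Prop 4.1 gives `|∂ₜv| ≲ M-dependent/(−t)^{3/2}` on the class).  Sources: KNSS 2009 Prop 4.1
(arXiv:0709.3599 p. 8) = tree `KNSS2009_prop41_mild_holds`; Chae–Wolf 2017 §3 Step 2
(arXiv:1610.09464 p. 9, the densification `λⱼ^{k} → μ`). -/
def ScaleDensification : Prop :=
  ∀ (M : ℝ) (c : ℕ → ℝ) (v : ℕ → ℝ → E3 → E3) (W : ℝ → E3 → E3),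
    (∀ n, 1 < c n) → Tendsto c atTop (𝓝 1) →
    (∀ n, IsTypeIAncientMild M (v n)) → (∀ n, IsDiscretelySelfSimilar (c n) (v n)) →
    IsTypeIAncientMild M W → (∀ t < 0, ∀ x, Tendsto (fun n => v n t x) atTop (𝓝 (W t x))) →
      ∀ μ : ℝ, 0 < μ → ∀ t < 0, ∀ x : E3, μ • W (μ ^ 2 * t) (μ • x) = W t x

/-- **S_G — THE SELF-SIMILAR GENERATOR (PROVED below, `selfSimilarGenerator_proof`, v2; was a stub in v1).**  A field of the class that
is invariant under all parabolic scalings on `t < 0` satisfies the infinitesimal identity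
`∇W(t)·x + W + 2t ∂ₜW = 0` there (differentiate `μ ↦ μ W(μ²t, μx)` at `μ = 1`; the class is jointly
`C^∞` on the open slab) — the hypothesis form, with centre `a = 0`, of the closed item
`ExtremalTypeIConstant.SelfSimilarExcluded` (stmt-NavierStokesRegularity-8219).  Why it might fail:
it does not (chain rule); kept as a separate stub because the `timeDeriv`/`fderiv` bookkeeping of the
uncurried field is real Lean work.  Sources: Leray 1934 (3.11); tree `SelfSimilar.lean`
(`IsSelfSimilar.eq_lerayBackward`), `WeakSolution.timeDeriv`. -/
def SelfSimilarGenerator : Prop :=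
  ∀ (M : ℝ) (W : ℝ → E3 → E3), IsTypeIAncientMild M W →
    (∀ μ : ℝ, 0 < μ → ∀ t < 0, ∀ x : E3, μ • W (μ ^ 2 * t) (μ • x) = W t x) →
      ∀ t < 0, ∀ x : E3, fderiv ℝ (W t) x ((0 : E3) + x) + W t x + (2 * t) • timeDeriv W t x = 0

/-- **THE RUNG: near-one DSS exclusion in the TIME-RATE class (no envelope).**  For every rate
constant `M` there is `c₁ = c₁(M) > 1` such that every Type-I ancient mild field `u ∈ A_M` (KNSS
Oseen gauge on `ℝ³ × (−∞,0)`: jointly smooth, divergence free, Oseen-mild between all pairs of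
negative times, `‖u(t,x)‖ ≤ M/√(−t)` — NO spatial decay) which is `c`-discretely self-similar about
the origin with `1 < c < c₁` vanishes on `t < 0`.  Print (Chae–Wolf 2017 Thm 1.3 = Pineau–Vicol 2026
Thm 1.6) needs the space–time envelope `C₀/(‖x‖ + √(−t))`; time-rate DSS profiles may a priori
carry satellite singular rays `{cᵏ e}` at the final time and lie outside `C((−∞,0);Lᵖ)`, so neither
Thm 1.1 nor Thm 1.3 applies to them. -/
def NearOneRateDss : Prop :=
  ∀ M : ℝ, ∃ c₁ : ℝ, 1 < c₁ ∧ ∀ c : ℝ, 1 < c → c < c₁ →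
    ∀ u : ℝ → E3 → E3, IsTypeIAncientMild M u → IsDiscretelySelfSimilar c u →
      ∀ t < 0, ∀ x, u t x = 0

/-! ## The former stubs — ALL PROVED (v4: S_A; v3: S_D; v2: S_G).  The file has no `sorry`. -/

/-- **Minimal-ratio recentring.**  If `u ∈ A_M` has an `ε`-active point and is `ε`-quiet in the
parabola of aperture `R > 0` about the time axis, then recentring at an active point of nearly
minimal similarity ratio and rescaling its time to `−1` produces `w ∈ A_M` with `‖w(−1,0)‖ ≥ ε` that
is `ε`-quiet on `{‖y‖ < R(√(−s) − 2)}`. -/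
theorem exists_recentred {ε M R : ℝ} (hR : 0 < R) {u : ℝ → E3 → E3} (hu : IsTypeIAncientMild M u)
    (hact : ∃ t < 0, ∃ x : E3, ε ≤ Real.sqrt (-t) * ‖u t x‖)
    (hq : ∀ t < 0, ∀ x : E3, ‖x‖ < R * Real.sqrt (-t) → Real.sqrt (-t) * ‖u t x‖ < ε) :
    ∃ w : ℝ → E3 → E3, IsTypeIAncientMild M w ∧ ε ≤ ‖w (-1) 0‖ ∧
      ∀ s < 0, ∀ y : E3, ‖y‖ < R * (Real.sqrt (-s) - 2) → Real.sqrt (-s) * ‖w s y‖ < ε := by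
  -- the set of similarity ratios of active points
  set S : Set ℝ := {r | ∃ t < 0, ∃ x : E3, ε ≤ Real.sqrt (-t) * ‖u t x‖ ∧ r = ‖x‖ / Real.sqrt (-t)}
    with hS_def
  have hne : S.Nonempty := by
    obtain ⟨t, ht, x, hx⟩ := hact
    exact ⟨‖x‖ / Real.sqrt (-t), t, ht, x, hx, rfl⟩
  have hbdd : BddBelow S := ⟨0, fun r ⟨t, ht, x, hx, hr⟩ => hr ▸ div_nonneg (norm_nonneg _) (Real.sqrt_nonneg _)⟩
  -- every active ratio is at least `R`
  have hlb : ∀ r ∈ S, R ≤ r := by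
    rintro r ⟨t, ht, x, hx, rfl⟩
    have hst : 0 < Real.sqrt (-t) := Real.sqrt_pos.2 (by linarith)
    rw [le_div_iff₀ hst]
    by_contra h
    exact absurd (hq t ht x (lt_of_not_ge h)) (not_lt.2 hx)
  set ρ : ℝ := sInf S with hρ_def
  have hRρ : R ≤ ρ := le_csInf hne hlb
  have hρ : 0 < ρ := hR.trans_le hRρ
  -- an active point of nearly minimal ratio
  obtain ⟨r, hrS, hr2⟩ := exists_lt_of_csInf_lt hne (show sInf S < 2 * ρ by linarith)
  obtain ⟨t₀, ht₀, x₀, hx₀, rfl⟩ := hrS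
  -- minimality: points of ratio `< ρ` are quiet
  have hmin : ∀ t < 0, ∀ x : E3, ‖x‖ / Real.sqrt (-t) < ρ → Real.sqrt (-t) * ‖u t x‖ < ε := by
    intro t ht x hlt
    by_contra h
    have hmem : ‖x‖ / Real.sqrt (-t) ∈ S := ⟨t, ht, x, not_lt.1 h, rfl⟩
    exact absurd (csInf_le hbdd hmem) (not_le.2 hlt)
  -- recentre at `x₀`, rescale `t₀` to `-1`
  set lam : ℝ := Real.sqrt (-t₀) with hlam_def
  have hlam : 0 < lam := Real.sqrt_pos.2 (by linarith)
  have hlam2 : lam ^ 2 = -t₀ := Real.sq_sqrt (by linarith)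
  set w : ℝ → E3 → E3 := nsRescale lam (fun t x => u t (x + x₀)) with hw_def
  have hw : IsTypeIAncientMild M w := (hu.comp_add_right x₀).nsRescale hlam
  have hw_apply : ∀ s y, w s y = lam • u (lam ^ 2 * s) (lam • y + x₀) := fun s y => rfl
  refine ⟨w, hw, ?_, ?_⟩
  · -- size at `(-1, 0)`
    rw [hw_apply, smul_zero, zero_add, hlam2, show -t₀ * (-1 : ℝ) = t₀ by ring, norm_smul,
      Real.norm_of_nonneg hlam.le]
    exact hx₀
  · intro s hs y hy
    have hss : 0 < Real.sqrt (-s) := Real.sqrt_pos.2 (by linarith)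
    -- the hypothesis is vacuous unless `√(-s) - 2 > 0`
    have hpos : 0 < Real.sqrt (-s) - 2 := by
      by_contra h
      have : R * (Real.sqrt (-s) - 2) ≤ 0 := mul_nonpos_of_nonneg_of_nonpos hR.le (not_lt.1 h)
      exact absurd (hy.trans_le this) (not_lt.2 (norm_nonneg y))
    have hy' : ‖y‖ < ρ * (Real.sqrt (-s) - 2) :=
      hy.trans_le (mul_le_mul_of_nonneg_right hRρ hpos.le)
    -- the original point
    have ht : lam ^ 2 * s < 0 := mul_neg_of_pos_of_neg (by positivity) hs
    have hsqrt : Real.sqrt (-(lam ^ 2 * s)) = lam * Real.sqrt (-s) := by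
      rw [show -(lam ^ 2 * s) = lam ^ 2 * (-s) by ring, Real.sqrt_mul (by positivity),
        Real.sqrt_sq hlam.le]
    have hr₀ : ‖x₀‖ / lam < 2 * ρ := hr2
    have hratio : ‖lam • y + x₀‖ / Real.sqrt (-(lam ^ 2 * s)) < ρ := by
      rw [hsqrt, div_lt_iff₀ (mul_pos hlam hss)]
      have h1 : ‖lam • y + x₀‖ ≤ lam * ‖y‖ + ‖x₀‖ := by
        calc ‖lam • y + x₀‖ ≤ ‖lam • y‖ + ‖x₀‖ := norm_add_le _ _
          _ = lam * ‖y‖ + ‖x₀‖ := by rw [norm_smul, Real.norm_of_nonneg hlam.le]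
      have h2 : ‖x₀‖ < 2 * ρ * lam := by rwa [div_lt_iff₀ hlam] at hr₀
      have h3 : lam * ‖y‖ < lam * (ρ * (Real.sqrt (-s) - 2)) := mul_lt_mul_of_pos_left hy' hlam
      nlinarith
    have hquiet := hmin (lam ^ 2 * s) ht (lam • y + x₀) hratio
    -- transport the value
    have e : Real.sqrt (-s) * ‖w s y‖ = Real.sqrt (-(lam ^ 2 * s)) * ‖u (lam ^ 2 * s) (lam • y + x₀)‖ := by
      rw [hw_apply, norm_smul, Real.norm_of_nonneg hlam.le, hsqrt]; ring
    rw [e]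
    exact hquiet

/-- **S_A PROVED (v4, 2026-08-28): axis activity.**  Take `ε` = the threshold of the end Liouville
theorem `exists_typeIAncientMild_eq_zero_of_small_on_end`.  If for some `M` no aperture works, pick for
every `n` a nontrivial `uₙ ∈ A_M` that is `ε`-quiet in the parabola of aperture `n + 1`; each `uₙ` has an
`ε`-active point (else it is `ε`-small on an end, hence zero); recentre at an active point of nearly
minimal similarity ratio (`exists_recentred`): `wₙ ∈ A_M`, `‖wₙ(−1,0)‖ ≥ ε`, `ε`-quiet on
`{‖y‖ < (n+1)(√(−s) − 2)}`; by the class compactness theorem `exists_tendsto_of_isTypeIAncientMild_seq`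
(BY NAME) a subsequence converges pointwise to `W ∈ A_M` with `‖W(−1,0)‖ ≥ ε` and `ε`-small on the end
`s ≤ −5` — so `W ≡ 0` by the end Liouville theorem: contradiction. -/
theorem axisActivity_proof : AxisActivity := by
  obtain ⟨ε, hε, hLiou⟩ := exists_typeIAncientMild_eq_zero_of_small_on_end
  refine ⟨ε, hε, fun M => ?_⟩
  by_contra hcon
  push_neg at hcon
  -- for every aperture `n + 1` a nontrivial quiet-in-the-parabola element
  choose u hu hnt hq using fun n : ℕ => hcon ((n : ℝ) + 1)
  -- each has an active point (else the end Liouville theorem makes it zero)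
  have hact : ∀ n, ∃ t < 0, ∃ x : E3, ε ≤ Real.sqrt (-t) * ‖u n t x‖ := by
    intro n
    by_contra h
    push_neg at h
    have hsmall : ∀ t, t ≤ -(1 : ℝ) → ∀ x, ‖u n t x‖ ≤ ε / Real.sqrt (-t) := by
      intro t ht x
      have hst : 0 < Real.sqrt (-t) := Real.sqrt_pos.2 (by linarith)
      rw [le_div_iff₀ hst, mul_comm]
      exact (h t (by linarith) x).le
    have hzero := hLiou M (u n) (hu n) 1 one_pos hsmall
    obtain ⟨t, ht, x, hx⟩ := hnt n
    exact hx (hzero t ht x)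
  -- recentred elements
  have hrec := fun n : ℕ => exists_recentred (ε := ε) (M := M) (R := (n : ℝ) + 1) (by positivity)
    (hu n) (hact n) (hq n)
  choose w hw hwε hwq using hrec
  -- compactness of the class
  obtain ⟨φ, hφ, W, hW, hpt, -, -, -⟩ := exists_tendsto_of_isTypeIAncientMild_seq M hw
  -- the limit is large at `(-1, 0)` …
  have hW1 : ε ≤ ‖W (-1) 0‖ :=
    ge_of_tendsto ((hpt (-1) (by norm_num) 0).norm) (Eventually.of_forall fun j => hwε (φ j))
  -- … and `ε`-quiet on the end `t ≤ -5`
  have hWsmall : ∀ t, t ≤ -(5 : ℝ) → ∀ x, ‖W t x‖ ≤ ε / Real.sqrt (-t) := by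
    intro s hs y
    have hs0 : s < 0 := by linarith
    have hss : 0 < Real.sqrt (-s) := Real.sqrt_pos.2 (by linarith)
    have hpos : 0 < Real.sqrt (-s) - 2 := by
      have : (2 : ℝ) < Real.sqrt (-s) := by
        rw [show (2 : ℝ) = Real.sqrt 4 by rw [show (4 : ℝ) = 2 ^ 2 by norm_num, Real.sqrt_sq (by norm_num)]]
        exact Real.sqrt_lt_sqrt (by norm_num) (by linarith)
      linarith
    have hT : Tendsto (fun j => ((φ j : ℕ) : ℝ) + 1) atTop atTop :=
      tendsto_atTop_add_const_right _ _ (tendsto_natCast_atTop_atTop.comp hφ.tendsto_atTop)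
    have hev : ∀ᶠ j in atTop, Real.sqrt (-s) * ‖w (φ j) s y‖ ≤ ε := by
      filter_upwards [(hT.atTop_mul_const hpos).eventually_gt_atTop ‖y‖] with j hj
      exact (hwq (φ j) s hs0 y hj).le
    have hlim : Tendsto (fun j => Real.sqrt (-s) * ‖w (φ j) s y‖) atTop (𝓝 (Real.sqrt (-s) * ‖W s y‖)) :=
      ((hpt s hs0 y).norm).const_mul _
    have h := le_of_tendsto hlim hev
    rw [le_div_iff₀ hss, mul_comm]
    exact h
  have hzero := hLiou M W hW 5 (by norm_num) hWsmall
  have h0 : W (-1) 0 = 0 := hzero (-1) (by norm_num) 0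
  rw [h0, norm_zero] at hW1
  exact absurd hW1 (not_le.2 hε)

/-- ℕ-iterates of a discrete self-similarity (`nsRescale_mul`, `nsRescale_one`). -/
theorem isDiscretelySelfSimilar_pow {c : ℝ} {u : ℝ → E3 → E3}
    (h : IsDiscretelySelfSimilar c u) (k : ℕ) : IsDiscretelySelfSimilar (c ^ k) u := by
  induction k with
  | zero =>
    show nsRescale (c ^ 0) u = u
    rw [pow_zero, nsRescale_one]
  | succ k ih =>
    have h' : nsRescale c u = u := h
    have ih' : nsRescale (c ^ k) u = u := ih
    show nsRescale (c ^ (k + 1)) u = u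
    rw [pow_succ, nsRescale_mul, ih', h']

/-- **S_D PROVED (v3, 2026-08-28): scale densification.**  Reduce to `1 ≤ μ` (apply the statement at
`μ⁻¹` to the point `(μ²t, μx)`); take `kₙ = ⌊log μ / log cₙ⌋₊`, `mₙ = cₙ^{kₙ}`, so `μ/cₙ < mₙ ≤ μ` and
`mₙ → μ`; iterate the DSS (`isDiscretelySelfSimilar_pow`): `vₙ(t,x) = mₙ vₙ(mₙ²t, mₙx)`; pass to the
limit at the MOVING arguments with the class-uniform KNSS Prop 4.1 bounds already in the tree —
`exists_norm_iteratedFDeriv_le_of_typeI M 1` (⇒ spatial Lipschitz on the slice `μ²t`, mean value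
inequality) and `exists_lipschitz_time_of_typeI M 0` (time-Lipschitz on the window `[μ²t − ½, μ²t/2)`) —
plus the pointwise convergence at the fixed point `(μ²t, μx)`; conclude by uniqueness of limits.
This is also the critic's P2 (09:24:02Z) answered in the kernel: the equicontinuity input is cited BY
NAME, nothing new is landed. -/
theorem scaleDensification_proof : ScaleDensification := by
  intro M c v W hc1 hc hv hdss hW hpt
  -- reduction to `1 ≤ μ` (apply the result at `μ⁻¹` to the point `(μ²t, μx)`)
  suffices H : ∀ μ : ℝ, 1 ≤ μ → ∀ t < 0, ∀ x : E3, μ • W (μ ^ 2 * t) (μ • x) = W t x by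
    intro μ hμ t ht x
    rcases le_or_gt 1 μ with h1 | h1
    · exact H μ h1 t ht x
    · have hμ' : 1 ≤ μ⁻¹ := by
        have hμi : 0 < μ⁻¹ := inv_pos.2 hμ
        nlinarith [mul_inv_cancel₀ hμ.ne']
      have ht' : μ ^ 2 * t < 0 := mul_neg_of_pos_of_neg (by positivity) ht
      have key := H μ⁻¹ hμ' (μ ^ 2 * t) ht' (μ • x)
      have e1 : μ⁻¹ ^ 2 * (μ ^ 2 * t) = t := by field_simp
      have e2 : μ⁻¹ • μ • x = x := by rw [smul_smul, inv_mul_cancel₀ hμ.ne', one_smul]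
      rw [e1, e2] at key
      rw [← key, smul_smul, mul_inv_cancel₀ hμ.ne', one_smul]
  intro μ hμ1 t ht x
  have hμ : 0 < μ := zero_lt_one.trans_le hμ1
  have hlogμ : 0 ≤ Real.log μ := Real.log_nonneg hμ1
  set s : ℝ := μ ^ 2 * t with hs_def
  have hs : s < 0 := mul_neg_of_pos_of_neg (by positivity) ht
  -- densifying exponents `k n = ⌊log μ / log cₙ⌋`, ratios `m n = cₙ ^ k n → μ`
  have hcpos : ∀ n, 0 < c n := fun n => zero_lt_one.trans (hc1 n)
  have hL : ∀ n, 0 < Real.log (c n) := fun n => Real.log_pos (hc1 n)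
  set k : ℕ → ℕ := fun n => ⌊Real.log μ / Real.log (c n)⌋₊ with hk_def
  set m : ℕ → ℝ := fun n => c n ^ k n with hm_def
  have hm_pos : ∀ n, 0 < m n := fun n => pow_pos (hcpos n) _
  have hm_exp : ∀ n, m n = Real.exp ((k n : ℝ) * Real.log (c n)) := fun n => by
    rw [Real.exp_nat_mul, Real.exp_log (hcpos n)]
  have hm_le : ∀ n, m n ≤ μ := fun n => by
    have h1 : (k n : ℝ) ≤ Real.log μ / Real.log (c n) :=
      Nat.floor_le (div_nonneg hlogμ (hL n).le)
    rw [le_div_iff₀ (hL n)] at h1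
    rw [hm_exp n]
    calc Real.exp ((k n : ℝ) * Real.log (c n)) ≤ Real.exp (Real.log μ) := Real.exp_le_exp.2 h1
      _ = μ := Real.exp_log hμ
  have hm_gt : ∀ n, μ / c n < m n := fun n => by
    have h2 : Real.log μ / Real.log (c n) < (k n : ℝ) + 1 := Nat.lt_floor_add_one _
    rw [div_lt_iff₀ (hL n)] at h2
    rw [div_lt_iff₀ (hcpos n)]
    have e : m n * c n = Real.exp (((k n : ℝ) + 1) * Real.log (c n)) := by
      rw [show ((k n : ℝ) + 1) = ((k n + 1 : ℕ) : ℝ) by push_cast; ring, Real.exp_nat_mul,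
        Real.exp_log (hcpos n), pow_succ]
    rw [e]
    calc μ = Real.exp (Real.log μ) := (Real.exp_log hμ).symm
      _ < _ := Real.exp_lt_exp.2 h2
  have hm : Tendsto m atTop (𝓝 μ) := by
    have hlow : Tendsto (fun n => μ / c n) atTop (𝓝 μ) := by
      have h : Tendsto (fun n => μ / c n) atTop (𝓝 (μ / 1)) :=
        tendsto_const_nhds.div hc one_ne_zero
      simpa using h
    exact tendsto_of_tendsto_of_tendsto_of_le_of_le hlow tendsto_const_nhds
      (fun n => (hm_gt n).le) (fun n => hm_le n)
  -- the DSS identity at the densifying ratios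
  have hid : ∀ n, m n • v n (m n ^ 2 * t) (m n • x) = v n t x := fun n => by
    have h : nsRescale (m n) (v n) = v n := isDiscretelySelfSimilar_pow (hdss n) (k n)
    have h' := congrFun (congrFun h t) x
    simpa only [nsRescale_apply] using h'
  -- class-uniform bounds on the window `[s - 1/2, s/2)` (KNSS Prop. 4.1, in tree)
  have hab : s - 1 < s / 2 := by linarith
  have hb : s / 2 < 0 := by linarith
  obtain ⟨K, hK⟩ := exists_norm_iteratedFDeriv_le_of_typeI M 1 hab hb one_half_pos
  obtain ⟨L, hL0, hLip⟩ := exists_lipschitz_time_of_typeI M 0 hab hb one_half_pos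
  have hKn : ∀ n, ∀ τ ∈ Ico (s - 1 + 1 / 2) (s / 2), ∀ y : E3, ‖fderiv ℝ (v n τ) y‖ ≤ K :=
    fun n τ hτ y => by
    have h := hK (hv n).continuousOn_uncurry (fun t ht => (hv n).isWeaklyDivFree ht)
      (fun s' t' hst ht' x => (hv n).mild_eq_heatExtension hst ht' x) (hv n).hasTypeITimeDecay τ hτ y
    rwa [norm_iteratedFDeriv_one] at h
  have hLn : ∀ n, ∀ σ ∈ Ico (s - 1 + 1 / 2) (s / 2), ∀ τ ∈ Ico (s - 1 + 1 / 2) (s / 2), ∀ y : E3,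
      ‖v n τ y - v n σ y‖ ≤ L * |τ - σ| := fun n σ hσ τ hτ y => by
    have h := hLip (hv n).continuousOn_uncurry (fun t ht => (hv n).isWeaklyDivFree ht)
      (fun s' t' hst ht' x => (hv n).mild_eq_heatExtension hst ht' x) (hv n).hasTypeITimeDecay
      σ hσ τ hτ y
    rwa [DerivInterp.norm_iteratedFDeriv_zero_sub] at h
  have hsI : s ∈ Ico (s - 1 + 1 / 2) (s / 2) := ⟨by linarith, by linarith⟩
  -- spatial Lipschitz on the slice `s` (mean value inequality)
  have hspace : ∀ n, ‖v n s (m n • x) - v n s (μ • x)‖ ≤ K * ‖m n • x - μ • x‖ := fun n => by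
    have hdiff : ∀ y ∈ (univ : Set E3), DifferentiableAt ℝ (v n s) y := fun y _ =>
      (((hv n).contDiff_slice hs).differentiable (by simp)).differentiableAt
    exact (convex_univ).norm_image_sub_le_of_norm_fderiv_le hdiff (fun y _ => hKn n s hsI y)
      (mem_univ _) (mem_univ _)
  -- the moving times `m n ^ 2 * t → s` eventually lie in the window
  have hsn : Tendsto (fun n => m n ^ 2 * t) atTop (𝓝 s) := (hm.pow 2).mul_const t
  have hwin : ∀ᶠ n in atTop, m n ^ 2 * t ∈ Ico (s - 1 + 1 / 2) (s / 2) := by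
    have hO : Ioo (s - 1 / 2) (s / 2) ∈ 𝓝 s := Ioo_mem_nhds (by linarith) (by linarith)
    filter_upwards [hsn hO] with n hn
    exact ⟨by linarith [hn.1], hn.2⟩
  -- convergence of the moved values
  have hA : Tendsto (fun n => v n (m n ^ 2 * t) (m n • x)) atTop (𝓝 (W s (μ • x))) := by
    rw [tendsto_iff_norm_sub_tendsto_zero]
    have g1 : Tendsto (fun n => L * |m n ^ 2 * t - s|) atTop (𝓝 0) := by
      have h := (tendsto_iff_norm_sub_tendsto_zero.1 hsn).const_mul L
      simpa [Real.norm_eq_abs] using h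
    have g2 : Tendsto (fun n => K * ‖m n • x - μ • x‖) atTop (𝓝 0) := by
      have h := (tendsto_iff_norm_sub_tendsto_zero.1 (hm.smul_const x)).const_mul K
      simpa using h
    have g3 : Tendsto (fun n => ‖v n s (μ • x) - W s (μ • x)‖) atTop (𝓝 0) :=
      tendsto_iff_norm_sub_tendsto_zero.1 (hpt s hs (μ • x))
    have gsum : Tendsto (fun n => L * |m n ^ 2 * t - s| + K * ‖m n • x - μ • x‖ +
        ‖v n s (μ • x) - W s (μ • x)‖) atTop (𝓝 0) := by
      simpa using (g1.add g2).add g3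
    refine squeeze_zero' (Eventually.of_forall fun n => norm_nonneg _) ?_ gsum
    filter_upwards [hwin] with n hn
    calc ‖v n (m n ^ 2 * t) (m n • x) - W s (μ • x)‖
        = ‖(v n (m n ^ 2 * t) (m n • x) - v n s (m n • x)) + (v n s (m n • x) - v n s (μ • x)) +
            (v n s (μ • x) - W s (μ • x))‖ := by congr 1; abel
      _ ≤ ‖v n (m n ^ 2 * t) (m n • x) - v n s (m n • x)‖ + ‖v n s (m n • x) - v n s (μ • x)‖ +
            ‖v n s (μ • x) - W s (μ • x)‖ := norm_add₃_le
      _ ≤ L * |m n ^ 2 * t - s| + K * ‖m n • x - μ • x‖ + ‖v n s (μ • x) - W s (μ • x)‖ := by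
          gcongr
          · exact hLn n s hsI (m n ^ 2 * t) hn (m n • x)
          · exact hspace n
  -- conclude by uniqueness of limits
  have hB : Tendsto (fun n => m n • v n (m n ^ 2 * t) (m n • x)) atTop (𝓝 (μ • W s (μ • x))) :=
    hm.smul hA
  have hB' : Tendsto (fun n => v n t x) atTop (𝓝 (μ • W s (μ • x))) := by
    refine hB.congr' (Eventually.of_forall fun n => hid n)
  exact (tendsto_nhds_unique hB' (hpt t ht x))

/-- **S_G PROVED (v2, 2026-08-28): the self-similar generator identity.**  Differentiate the constant
map `μ ↦ μ • W (μ² t) (μ • x)` at `μ = 1` along the curve `μ ↦ (μ² t, μ • x)` through the open slab,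
where `uncurry W` is `C^∞` (`IsTypeIAncientMild.contDiffOn`); the Fréchet derivative `L` of `uncurry W` at
`(t, x)` splits as `L (2t, x) = (2t) • L (1, 0) + L (0, x) = (2t) • timeDeriv W t x + fderiv ℝ (W t) x x`. -/
theorem selfSimilarGenerator_proof : SelfSimilarGenerator := by
  intro M W hW hsc t ht x
  have hopen : IsOpen (Iio (0 : ℝ) ×ˢ (univ : Set E3)) := isOpen_Iio.prod isOpen_univ
  have hmem : (t, x) ∈ Iio (0 : ℝ) ×ˢ (univ : Set E3) := ⟨ht, mem_univ _⟩
  have hd : DifferentiableAt ℝ (uncurry W) (t, x) :=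
    ((hW.contDiffOn.differentiableOn (by simp)).differentiableAt (hopen.mem_nhds hmem))
  set L : ℝ × E3 →L[ℝ] E3 := fderiv ℝ (uncurry W) (t, x) with hLdef
  have hL : HasFDerivAt (uncurry W) L (t, x) := hd.hasFDerivAt
  -- the curve `μ ↦ (μ² t, μ x)` and the constant map along it
  have hγ : HasDerivAt (fun μ : ℝ => (μ ^ 2 * t, μ • x))
      ((2 : ℕ) * (1 : ℝ) ^ (2 - 1) * t, (1 : ℝ) • x) 1 :=
    ((hasDerivAt_pow 2 (1 : ℝ)).mul_const t).prodMk ((hasDerivAt_id (1 : ℝ)).smul_const x)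
  have hL1 : HasFDerivAt (uncurry W) L ((1 : ℝ) ^ 2 * t, (1 : ℝ) • x) := by simpa using hL
  have hG : HasDerivAt (fun μ : ℝ => uncurry W (μ ^ 2 * t, μ • x))
      (L ((2 : ℕ) * (1 : ℝ) ^ (2 - 1) * t, (1 : ℝ) • x)) 1 := by
    have := hL1.comp_hasDerivAt (1 : ℝ) hγ
    exact this.congr_of_eventuallyEq (Eventually.of_forall fun μ => rfl)
  have hΦ : HasDerivAt (fun μ : ℝ => μ • uncurry W (μ ^ 2 * t, μ • x))
      ((id (1 : ℝ) : ℝ) • L ((2 : ℕ) * (1 : ℝ) ^ (2 - 1) * t, (1 : ℝ) • x)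
        + (1 : ℝ) • uncurry W ((1 : ℝ) ^ 2 * t, (1 : ℝ) • x)) 1 := by
    have := (hasDerivAt_id (1 : ℝ)).smul hG
    exact this.congr_of_eventuallyEq (Eventually.of_forall fun μ => rfl)
  have hev : (fun μ : ℝ => μ • uncurry W (μ ^ 2 * t, μ • x)) =ᶠ[𝓝 1] fun _ => W t x := by
    filter_upwards [Ioi_mem_nhds (zero_lt_one : (0 : ℝ) < 1)] with μ hμ
    simpa [uncurry] using hsc μ hμ t ht x
  have h0 : HasDerivAt (fun μ : ℝ => μ • uncurry W (μ ^ 2 * t, μ • x)) (0 : E3) 1 :=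
    (hasDerivAt_const (1 : ℝ) (W t x)).congr_of_eventuallyEq hev
  have hkey : L (2 * t, x) + W t x = 0 := by
    have h := hΦ.unique h0
    simpa [uncurry] using h
  -- identify the partial derivatives with `timeDeriv` and `fderiv` of the slice
  have htime : timeDeriv W t x = L (1, 0) := by
    have h1 : HasDerivAt (fun s : ℝ => (s, x)) ((1 : ℝ), (0 : E3)) t :=
      (hasDerivAt_id t).prodMk (hasDerivAt_const t x)
    have h2 : HasDerivAt (fun s : ℝ => W s x) (L ((1 : ℝ), (0 : E3))) t := by
      have := hL.comp_hasDerivAt t h1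
      exact this.congr_of_eventuallyEq (Eventually.of_forall fun s => rfl)
    rw [timeDeriv_apply]
    exact h2.deriv
  have hspace : fderiv ℝ (W t) x = L.comp (ContinuousLinearMap.inr ℝ ℝ E3) := by
    have h1 : HasFDerivAt (fun y : E3 => (t, y)) (ContinuousLinearMap.inr ℝ ℝ E3) x :=
      hasFDerivAt_prodMk_right t x
    have h2 : HasFDerivAt (W t) (L.comp (ContinuousLinearMap.inr ℝ ℝ E3)) x := by
      have := hL.comp x h1
      exact this.congr_of_eventuallyEq (Eventually.of_forall fun y => rfl)
    exact h2.fderiv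
  have hsplit : L (2 * t, x) = (2 * t) • L (1, 0) + L (0, x) := by
    have : ((2 * t, x) : ℝ × E3) = (2 * t) • ((1 : ℝ), (0 : E3)) + ((0 : ℝ), x) := by
      ext <;> simp
    rw [this, map_add, map_smul]
  rw [zero_add, hspace, htime, ContinuousLinearMap.comp_apply, ContinuousLinearMap.inr_apply]
  rw [hsplit] at hkey
  have : L (0, x) + W t x + (2 * t) • L (1, 0) = (2 * t) • L (1, 0) + L (0, x) + W t x := by abel
  rw [this]; exact hkey

/-! ## Elementary facts about the scaling -/

/-- Commuting scalings: a rescaled `c`-DSS field is `c`-DSS (about the same centre, the origin). -/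
theorem isDiscretelySelfSimilar_nsRescale {c μ : ℝ} {u : ℝ → E3 → E3}
    (h : IsDiscretelySelfSimilar c u) : IsDiscretelySelfSimilar c (nsRescale μ u) := by
  have e : nsRescale c u = u := h
  show nsRescale c (nsRescale μ u) = nsRescale μ u
  rw [← nsRescale_mul, mul_comm, nsRescale_mul, e]

/-- The value of the parabolic rescaling to time `−1` at the marked point:
`(u_λ)(−1, λ⁻¹x₀) = λ u(t₀, x₀)`, `λ = √(−t₀)`. -/
theorem nsRescale_sqrt_apply {t₀ : ℝ} (ht₀ : t₀ < 0) (u : ℝ → E3 → E3) (x₀ : E3) :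
    nsRescale (Real.sqrt (-t₀)) u (-1) ((Real.sqrt (-t₀))⁻¹ • x₀) = Real.sqrt (-t₀) • u t₀ x₀ := by
  have hs : 0 < Real.sqrt (-t₀) := Real.sqrt_pos.2 (neg_pos.2 ht₀)
  rw [nsRescale_apply, smul_smul, mul_inv_cancel₀ hs.ne', one_smul, mul_neg_one,
    Real.sq_sqrt (neg_nonneg.2 ht₀.le), neg_neg]

/-! ## The composition: the indirect argument, kernel-checked -/

/-- **`AxisActivity → ScaleDensification → SelfSimilarGenerator → NearOneRateDss`.**  Suppose the
rung fails for some `M`: for every `n` there are `cₙ ∈ (1, 1 + 1/(n+1))` and a nontrivial `cₙ`-DSS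
`uₙ ∈ A_M`.  S_A marks a point `(tₙ, xₙ)` with `‖xₙ‖ < R₀√(−tₙ)` and `√(−tₙ)‖uₙ(tₙ,xₙ)‖ ≥ ε`; the
parabolic rescaling `vₙ = (uₙ)_{√(−tₙ)}` stays in `A_M` (`IsTypeIAncientMild.nsRescale`), stays
`cₙ`-DSS about the origin (commuting scalings) and has `‖vₙ(−1, yₙ)‖ ≥ ε` at `yₙ = xₙ/√(−tₙ)`,
`‖yₙ‖ < R₀`.  Bolzano–Weierstrass gives `yₙ → y_inf` along a subsequence, the class compactness theorem
`exists_tendsto_of_isTypeIAncientMild_seq` a further subsequence converging (pointwise, and locally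
uniformly on slices) to `W ∈ A_M`; locally uniform convergence on the slice `t = −1` and continuity of
`W(−1,·)` give `‖W(−1, y_inf)‖ ≥ ε`.  By S_D (`cₙ → 1`) `W` is scale invariant on `t < 0`, by S_G it
satisfies the generator identity, and the CLOSED item `SelfSimilarExcluded`
(`extremalTypeIConstant_selfSimilarExcluded_proof`: Tsai 1998 Thm 1 at `q = ∞` + the Oseen identity)
makes `W ≡ 0` on `t < 0` — contradicting `‖W(−1, y_inf)‖ ≥ ε > 0`. -/
theorem nearOneRateDss_of (hA : AxisActivity) (hD : ScaleDensification)
    (hG : SelfSimilarGenerator) : NearOneRateDss := by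
  obtain ⟨ε, hε, hAct⟩ := hA
  intro M
  obtain ⟨R₀, hR₀⟩ := hAct M
  by_contra H
  push_neg at H
  -- a violating sequence `cₙ ↓ 1`
  have hseq : ∀ n : ℕ, ∃ c : ℝ, 1 < c ∧ c < 1 + 1 / ((n : ℝ) + 1) ∧ ∃ u : ℝ → E3 → E3,
      IsTypeIAncientMild M u ∧ IsDiscretelySelfSimilar c u ∧ ∃ t < 0, ∃ x, u t x ≠ 0 := by
    intro n
    have hpos : (0 : ℝ) < 1 / ((n : ℝ) + 1) := by positivity
    obtain ⟨c, hc1, hc2, u, hu, hdss, t, ht, x, hx⟩ := H (1 + 1 / ((n : ℝ) + 1)) (by linarith)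
    exact ⟨c, hc1, hc2, u, hu, hdss, t, ht, x, hx⟩
  choose c hc1 hc2 u hu hdss hnt using hseq
  -- active points inside the parabola (S_A)
  have hact : ∀ n, ∃ t < 0, ∃ x : E3, ‖x‖ < R₀ * Real.sqrt (-t) ∧
      ε ≤ Real.sqrt (-t) * ‖u n t x‖ := fun n => hR₀ (u n) (hu n) (hnt n)
  choose t ht x hxR hxε using hact
  -- parabolic rescaling to time `−1`
  set μ : ℕ → ℝ := fun n => Real.sqrt (-(t n)) with hμ
  have hμpos : ∀ n, 0 < μ n := fun n => Real.sqrt_pos.2 (neg_pos.2 (ht n))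
  set v : ℕ → ℝ → E3 → E3 := fun n => nsRescale (μ n) (u n) with hv
  set y : ℕ → E3 := fun n => (μ n)⁻¹ • x n with hy
  have hvA : ∀ n, IsTypeIAncientMild M (v n) := fun n => (hu n).nsRescale (hμpos n)
  have hvdss : ∀ n, IsDiscretelySelfSimilar (c n) (v n) := fun n =>
    isDiscretelySelfSimilar_nsRescale (hdss n)
  have hyR : ∀ n, ‖y n‖ < R₀ := fun n => by
    have h1 : ‖y n‖ = (μ n)⁻¹ * ‖x n‖ := by
      rw [hy, norm_smul, norm_inv, Real.norm_of_nonneg (hμpos n).le]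
    rw [h1, inv_mul_lt_iff₀ (hμpos n), mul_comm]
    exact hxR n
  have hval : ∀ n, ε ≤ ‖v n (-1) (y n)‖ := fun n => by
    have h1 : v n (-1) (y n) = μ n • u n (t n) (x n) := by
      rw [hv, hy]
      exact nsRescale_sqrt_apply (ht n) (u n) (x n)
    rw [h1, norm_smul, Real.norm_of_nonneg (hμpos n).le]
    exact hxε n
  -- Bolzano–Weierstrass for the marked points
  obtain ⟨yinf, -, ψ, hψ, hyψ⟩ := tendsto_subseq_of_bounded (Metric.isBounded_closedBall (x := (0 : E3))
    (r := R₀)) (x := y) (fun n => Metric.mem_closedBall.2 (by simpa [dist_zero_right] using (hyR n).le))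
  -- compactness of the class along the subsequence
  obtain ⟨φ, hφ, W, hW, hpt, -, hloc, -⟩ :=
    exists_tendsto_of_isTypeIAncientMild_seq M (w := fun j => v (ψ j)) (fun j => hvA (ψ j))
  -- nontriviality of the limit at `(−1, y_inf)`
  have hneg1 : (-1 : ℝ) < 0 := by norm_num
  have hyconv : Tendsto (fun j => y (ψ (φ j))) atTop (𝓝 yinf) := hyψ.comp hφ.tendsto_atTop
  have hlim : Tendsto (fun j => v (ψ (φ j)) (-1) (y (ψ (φ j)))) atTop (𝓝 (W (-1) yinf)) :=
    (hloc (-1) hneg1).tendsto_comp ((hW.continuous_slice hneg1).continuousAt) hyconv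
  have hWy : ε ≤ ‖W (-1) yinf‖ :=
    ge_of_tendsto hlim.norm (Eventually.of_forall fun j => hval (ψ (φ j)))
  -- `cₙ → 1` along the subsequence
  have hsub : Tendsto (fun j => ψ (φ j)) atTop atTop := hψ.tendsto_atTop.comp hφ.tendsto_atTop
  have hc_one : Tendsto (fun j => c (ψ (φ j))) atTop (𝓝 1) := by
    have hup : Tendsto (fun j => (1 : ℝ) + 1 / (((ψ (φ j) : ℕ) : ℝ) + 1)) atTop (𝓝 (1 + 0)) :=
      (tendsto_one_div_add_atTop_nhds_zero_nat.comp hsub).const_add 1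
    rw [add_zero] at hup
    exact tendsto_of_tendsto_of_tendsto_of_le_of_le tendsto_const_nhds hup
      (fun j => (hc1 _).le) (fun j => (hc2 _).le)
  -- scale invariance of the limit (S_D) and the generator identity (S_G)
  have hSS : ∀ μ' : ℝ, 0 < μ' → ∀ t' < 0, ∀ x' : E3, μ' • W (μ' ^ 2 * t') (μ' • x') = W t' x' :=
    hD M (fun j => c (ψ (φ j))) (fun j => v (ψ (φ j))) W (fun j => hc1 _) hc_one
      (fun j => hvA _) (fun j => hvdss _) hW hpt
  have hgen := hG M W hW hSS
  -- the closed item `SelfSimilarExcluded` kills the limit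
  obtain ⟨h1, h2, h3, h4⟩ := isTypeIAncientMild_iff.1 hW
  have hzero : W (-1) yinf = 0 :=
    extremalTypeIConstant_selfSimilarExcluded_proof M W ⟨h1, h2, h3, h4⟩ ⟨0, hgen⟩ (-1) hneg1 yinf
  rw [hzero, norm_zero] at hWy
  exact absurd hWy (not_le.2 hε)

/-- **THE RUNG IS A THEOREM (v4): near-one DSS Type-I exclusion in the rate class, no envelope.**
Sorry-free from `axisActivity_proof` (S_A), `scaleDensification_proof` (S_D), `selfSimilarGenerator_proof`
(S_G) and the tree.  No summit and no crux is proved by it: it is a rung on the DSS wall. -/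
theorem nearOneRateDss_proof : NearOneRateDss :=
  nearOneRateDss_of axisActivity_proof scaleDensification_proof selfSimilarGenerator_proof

/-- Old name kept for the registered-stub bookkeeping (v1–v3). -/
theorem nearOneRateDss_of_stubs : NearOneRateDss := nearOneRateDss_proof

/-! ## The envelope form is a tree theorem; the rung drops the envelope -/

/-- **The printed (envelope) form is ALREADY a theorem of the tree, inside the gauge class** —
`FiniteDissipationLiouville.Birth.exists_dss_threshold_of_envelope` (route `LerayQuarterDissipation`,
from the PROVED `chaeWolf2017_removing_dss_holds` + the classical continuation of gauge-class DSS
fields): for every envelope constant `C₀ > 0` a threshold `c₁(C₀) > 1` below which an enveloped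
`c`-DSS member of ANY rate class `A_M` vanishes.  Restated here so that the delta of the rung is
kernel-visible: `NearOneRateDss` is this statement with the hypothesis `HasTypeIDecay C₀ u` DELETED
and the threshold depending on the RATE constant `M` instead (an envelope constant produced by
Chae–Wolf Thm 1.1 depends on the solution, not on `M` — cf. the tree's `exists_dss_threshold`, whose
threshold depends on `w`). -/
theorem nearOneEnvelope_inTree {C₀ : ℝ} (hC₀ : 0 < C₀) :
    ∃ c₁ : ℝ, 1 < c₁ ∧ ∀ (M c : ℝ) (u : ℝ → E3 → E3), 1 < c → c < c₁ →
      IsTypeIAncientMild M u → HasTypeIDecay C₀ u → IsDiscretelySelfSimilar c u →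
        ∀ t < 0, ∀ x, u t x = 0 :=
  FiniteDissipationLiouville.Birth.exists_dss_threshold_of_envelope hC₀

/-- **Corollary: the rung implies the envelope form with a threshold uniform in the envelope
constant's companions** — trivially, since an envelope is not even used. -/
theorem nearOneEnvelope_of_nearOneRate (h : NearOneRateDss) :
    ∀ M : ℝ, ∃ c₁ : ℝ, 1 < c₁ ∧ ∀ (C₀ c : ℝ), 1 < c → c < c₁ →
      ∀ u : ℝ → E3 → E3, IsTypeIAncientMild M u → HasTypeIDecay C₀ u →
        IsDiscretelySelfSimilar c u → ∀ t < 0, ∀ x, u t x = 0 := by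
  intro M
  obtain ⟨c₁, hc₁, hc⟩ := h M
  exact ⟨c₁, hc₁, fun C₀ c h1 h2 u hu _ hdss => hc c h1 h2 u hu hdss⟩

/-- **Corollary (sequence form facing the technique class): no nontrivial Type-I ancient mild
fields with DSS factors accumulating at `1` at bounded rate** — if `uₙ ∈ A_M` are `cₙ`-DSS with
`cₙ > 1`, `cₙ → 1`, then all but finitely many vanish on `t < 0`. -/
theorem eventually_eq_zero_of_tendsto_one (h : NearOneRateDss) (M : ℝ) {cs : ℕ → ℝ}
    {us : ℕ → ℝ → E3 → E3} (hc : ∀ n, 1 < cs n) (hlim : Tendsto cs atTop (𝓝 1))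
    (hu : ∀ n, IsTypeIAncientMild M (us n)) (hdss : ∀ n, IsDiscretelySelfSimilar (cs n) (us n)) :
    ∀ᶠ n in atTop, ∀ t < 0, ∀ x, us n t x = 0 := by
  obtain ⟨c₁, hc₁, H⟩ := h M
  have hev : ∀ᶠ n in atTop, cs n < c₁ := hlim (Iio_mem_nhds hc₁)
  exact hev.mono fun n hn => H (cs n) (hc n) hn (us n) (hu n) (hdss n)

/-! ## Consumer inside the 23843 cone (v5): the residual object of both 23843 lines is not near-one DSS

The two registered 23843 lines (`scar_zoom` S_C′, `slice_budget` SK) have converged on ONE residual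
object (KEY-NS #117/#118): an Albritton–Barker-class TWIN-SCAR Type-I ancient mild solution
`ScarZoom.TwinScarObject M v` (in `A_M`, locally uniformly `L²` up to the top, singular at `(0,0)` and at
`(0,e)`, `‖e‖ = 1`).  The rung constrains it BY NAME: such an object is not `c`-DSS about ANY centre
`x₀` with `1 < c < c₁(M)` — because `A_M` is translation invariant (`IsTypeIAncientMild.comp_add_right`)
and a field vanishing on the open past is not singular anywhere.  (Like SF, this is a PROVED constraint
on the residual enemy, not a kill: the object need not be DSS at all.) -/

open Summit.NavierStokesRegularity.NavierStokesRegularity.Cruxes.ScarEnvelopeTypeI.ScarZoom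
  (TwinScarObject SingularAt) in
/-- **Corollary (v5, kernel).**  For every `M` there is `c₁(M) > 1` such that no twin-scar object of
Type-I constant `M` is `c`-discretely self-similar about any centre `x₀` with `1 < c < c₁(M)`. -/
theorem twinScarObject_not_nearOneDss (M : ℝ) :
    ∃ c₁ : ℝ, 1 < c₁ ∧ ∀ c : ℝ, 1 < c → c < c₁ →
      ∀ (v : ℝ → E3 → E3) (x₀ : E3), TwinScarObject M v →
        ¬ IsDiscretelySelfSimilar c (fun t x => v t (x + x₀)) := by
  obtain ⟨c₁, hc₁, h⟩ := nearOneRateDss_proof M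
  refine ⟨c₁, hc₁, fun c hc hcc v x₀ hv hdss => ?_⟩
  have hw : IsTypeIAncientMild M (fun t x => v t (x + x₀)) := hv.1.comp_add_right x₀
  have hzero := h c hc hcc _ hw hdss
  obtain ⟨t, ht, y, -, hA⟩ := hv.2.2.1 1 one_pos 0
  have h0 : v t y = 0 := by
    have := hzero t ht.2 (y - x₀)
    simpa using this
  rw [h0, norm_zero] at hA
  exact lt_irrefl 0 hA

/-! ## v6: the rung DOMINATES Chae–Wolf 2017 Thm 1.3 (kernel)

The envelope class of the Literature fact `chaeWolf2017_removing_dss` (classical on `(−∞,0)`,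
`‖u(t,x)‖ ≤ C₀/(‖x‖ + √(−t))`) lies inside the rate class `A_{C₀}` — the tree's
`isTypeIAncientMild_of_classical_typeI` (KNSS 2009 Thm 6.1 mildness clause, PROVED; file
`Theorems/QuantisedSymmetryPolyhedralDssProfileExistsStubAncientMildOfClassicalTypeI.lean`, used BY NAME).
Hence `NearOneRateDss → chaeWolf2017_removing_dss` is two lines, and the rung re-proves Chae–Wolf's
theorem by a different route (axis activity + KNSS compactness + Tsai `q = ∞` + the small-constant
Liouville theorem).  HONESTY: the tree ALREADY has `chaeWolf2017_removing_dss_holds`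
(`Literature/Analysis/FluidPDE/ChaeWolfRemovingDSSProofs.lean`, along the printed §3), so this is a
second kernel proof, recorded only to certify IN THE KERNEL that the rung is a (weakly) STRONGER
statement than the barrier's first conjunct `NearOneDssTypeIExclusion.1`: it drops the envelope. -/

open Summit.NavierStokesRegularity.NavierStokesRegularity.Theorems.PolyhedralDssProfileExists.Birth
  (isTypeIAncientMild_of_classical_typeI) in
/-- **The rung implies Chae–Wolf 2017 Thm 1.3 (v6, kernel).** [cite: ChaeWolf2017RemovingDSS, Theorem 1.3 (arXiv:1610.09464 p. 3)] -/
theorem chaeWolf_of_nearOneRateDss (h : NearOneRateDss) : chaeWolf2017_removing_dss := by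
  intro C₀ _hC₀
  obtain ⟨c₁, hc₁, hc⟩ := h C₀
  exact ⟨c₁, hc₁, fun c h1 h2 u p hcl hdss hdec =>
    hc c h1 h2 u (isTypeIAncientMild_of_classical_typeI hcl hdec) hdss⟩

/-- Chae–Wolf 2017 Thm 1.3 from the proved rung (a second kernel proof; the tree's first is
`Literature.Analysis.FluidPDE.chaeWolf2017_removing_dss_holds`). -/
theorem chaeWolf2017_removing_dss_proof' : chaeWolf2017_removing_dss :=
  chaeWolf_of_nearOneRateDss nearOneRateDss_proof

/-! ## v7: the same constraint on the residual object of 24077's registered line `thin_cascade`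

`thin_cascade` v5 (stmt-NavierStokesRegularity-24077; after the LEAD ns-tc-p1 g3's S2 landing only S3
`stub_thinCascadeLiouville` — the DSS wall — is open) has the residual THIN OBJECT
`ThinCascade.ThinObject M q v g`: a Type-I ancient mild field in `A_M`, locally uniformly `L²` up to
the top, singular at the origin, with a log-budgeted weak final trace `g`.  The rung constrains it
exactly as it constrains the twin-scar object: not `c`-DSS about any centre for `1 < c < c₁(M)`. -/

open Summit.NavierStokesRegularity.NavierStokesRegularity.Cruxes.TypeIQuantSubcubicExp.ThinCascade
  (ThinObject) in
/-- **Corollary (v7, kernel).**  For every `M` there is `c₁(M) > 1` such that no thin object of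
Type-I constant `M` (any budget `q`, any trace `g`) is `c`-discretely self-similar about any centre
`x₀` with `1 < c < c₁(M)`. -/
theorem thinObject_not_nearOneDss (M : ℝ) :
    ∃ c₁ : ℝ, 1 < c₁ ∧ ∀ c : ℝ, 1 < c → c < c₁ →
      ∀ (q : ℝ) (v : ℝ → E3 → E3) (g : E3 → E3) (x₀ : E3), ThinObject M q v g →
        ¬ IsDiscretelySelfSimilar c (fun t x => v t (x + x₀)) := by
  obtain ⟨c₁, hc₁, h⟩ := nearOneRateDss_proof M
  refine ⟨c₁, hc₁, fun c hc hcc q v g x₀ hv hdss => ?_⟩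
  have hw : IsTypeIAncientMild M (fun t x => v t (x + x₀)) := hv.1.comp_add_right x₀
  have hzero := h c hc hcc _ hw hdss
  obtain ⟨t, ht, y, -, hA⟩ := hv.2.2.1 1 one_pos 0
  have h0 : v t y = 0 := by
    have := hzero t ht.2 (y - x₀)
    simpa using this
  rw [h0, norm_zero] at hA
  exact lt_irrefl 0 hA

end Summit.NavierStokesRegularity.NavierStokesRegularity.Cruxes.ScarEnvelopeTypeI.AxisActivity

end
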